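import Mathlib
import Summits.Ventures.PercRepro2.Independence
import Summits.Ventures.PercRepro2.Harris
import Summits.Ventures.PercRepro2.HCov
import Summits.Ventures.PercRepro2.CutVertexPaths
import Summits.Ventures.PercRepro2.CutOneFarConn
import Summits.Ventures.PercRepro2.CutTwoFarConn
import Summits.Ventures.PercRepro2.CutTwoFarLaw
import Summits.Ventures.PercRepro2.CutTwoFar
import Summits.Ventures.PercRepro2.CutTwoFarHarris
import Summits.Ventures.PercRepro2.CutTwoFarRootsLaw
import Summits.Ventures.PercRepro2.CutTwoFarRightPat
import Summits.Ventures.PercRepro2.BHKAvoid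
import Summits.Ventures.PercRepro2.BHKEvents
import Summits.Ventures.PercRepro2.CutTwoFarA13Conn
import Summits.Ventures.PercRepro2.CutTwoFarA13Masses
import Summits.Ventures.PercRepro2.CutTwoFarA13Atoms
import Summits.Ventures.PercRepro2.CutTwoFarA13

/-!
# A root and `a₃` behind a cut vertex, V: THE TEN SLACKS ARE NONNEGATIVE (blind cell PercRepro2,
typer-1 g51)

The right-graph quantities of Part IV, each `≥ 0` by a kernel inequality of the classical toolbox
with the roots `a₂` (explored cluster `S = C(a₂)`) and `v` (avoided):
* `HAo = Q·bo − poH`, `HAb = Q·bb − pbH` — Harris, mixed form (`{a₂ ↮ v}` decreasing against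
  `{a₂ ↔ o}` / `{a₂ ↔ b}` increasing; `prob_inter_le_prob_mul_prob_of_isLowerSet`);
* `M = bbo − bo·bb`, `Mbx = bbx − bx·bb` — Harris for two increasing events
  (`prob_mul_prob_le_prob_inter`);
* `XLH = pbL·poH − Q·J_LH`, `XHL = pbH·poL − Q·J_HL` — BHK06 Thm 1.3 across the clusters `C(a₂)`
  and `C(v)` with the avoidance of `v` (`bhk_cross_cluster_avoid`, `s = a₂`, `t = v`, `X = {v}`);
* `SHH = Q·J_HH − pbH·poH` — BHK06 Thm 1.3 in the cluster `C(a₂)` given `a₂ ↮ v`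
  (`bhk_same_cluster_events`);
* `L1 = bo·pbL − J_LH`, `L2 = bb·poL − J_HL`, `Kh = L1 + J_HH − bo·pbH + bb·HAo` — the three
  division slacks: `Q·L1 = pbL·HAo + XLH`, `Q·L2 = poL·HAb + XHL`, `Q·Kh = SHH + XLH + HAo·(HAb +
  pbL)` are ring identities, so each is `≥ 0` when `Q > 0`, and each vanishes when `Q = 0` (every
  `Q′`-event is contained in `{a₂ ↮ v}`).  This is mine-2's exploration proof of (K) (MINE2-CUTVERTEX
  §13.12) with the functional BHK replaced by its two event forms (the functional inequality is
  linear in the second functional `1 + 1_b − ℓ_b`, so it is the sum of a same-cluster and a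
  cross-cluster instance), and Harris for the product term.
Hence **`HCov_a13Far`**: (HCOV) holds unconditionally on the class `{a₁, a₃}` of S3.5 — a root and
`a₃` behind a cut vertex, every weighted part, every weight vector — the SEVENTH two-far-mark class
in the kernel.  Own work; standard axioms.
-/

namespace Summit.Ventures.PercRepro2

open CovForm CutVertexM9 UnionCluster

namespace CutTwoFar

section A13Blocks

variable {V : Type*} {E : Type*} [Fintype E] [DecidableEq E] {R : Type*} [Field R]
variable {ends : E → Sym2 V} {side : E → Bool} {L : Set V} {v : V} {Rt : Set V}

variable [LinearOrder R] [IsStrictOrderedRing R] {o b a₁ a₂ a₃ : V} (p : E → R) (hp : IsProbVec p)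
include hp

omit [Fintype E] [DecidableEq E] hp in
/-- `{a₂ ↮ v}` is a decreasing event. -/
lemma isLowerSet_notConn : IsLowerSet {ω | ¬ Conn ends ω a₂ v} :=
  (isUpperSet_connEvent ends a₂ v).compl

omit [Fintype E] [DecidableEq E] hp in
/-- `{a₂ ↮ v} = (connEvent a₂ v)ᶜ`. -/
lemma notConn_eq_compl : {ω | ¬ Conn ends ω a₂ v} = (connEvent ends a₂ v)ᶜ := rfl

/-- **`HAo ≥ 0`** (Harris, mixed): `P(a₂ ↮ v, a₂ ↔ o) ≤ P(a₂ ↮ v) · P(a₂ ↔ o)`. -/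
theorem HAo_nonneg : 0 ≤ (prob p {ω | ¬ Conn ends ω a₂ v} * prob p {ω | Conn ends ω a₂ o} - prob p {ω | ¬ Conn ends ω a₂ v ∧ Conn ends ω a₂ o}) := by
  have key := prob_inter_le_prob_mul_prob_of_isLowerSet hp (isLowerSet_notConn (ends := ends) (v := v) (a₂ := a₂))
    (isUpperSet_connEvent ends a₂ o)
  have e : {ω | ¬ Conn ends ω a₂ v} ∩ connEvent ends a₂ o = {ω | ¬ Conn ends ω a₂ v ∧ Conn ends ω a₂ o} := rfl
  have eo : connEvent ends a₂ o = {ω | Conn ends ω a₂ o} := rfl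
  rw [e, eo] at key
  linarith

/-- **`HAb ≥ 0`** (Harris, mixed): `P(a₂ ↮ v, a₂ ↔ b) ≤ P(a₂ ↮ v) · P(a₂ ↔ b)`. -/
theorem HAb_nonneg : 0 ≤ (prob p {ω | ¬ Conn ends ω a₂ v} * prob p {ω | Conn ends ω a₂ b} - prob p {ω | ¬ Conn ends ω a₂ v ∧ Conn ends ω a₂ b}) := by
  have key := prob_inter_le_prob_mul_prob_of_isLowerSet hp (isLowerSet_notConn (ends := ends) (v := v) (a₂ := a₂))
    (isUpperSet_connEvent ends a₂ b)
  have e : {ω | ¬ Conn ends ω a₂ v} ∩ connEvent ends a₂ b = {ω | ¬ Conn ends ω a₂ v ∧ Conn ends ω a₂ b} := rfl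
  have eb : connEvent ends a₂ b = {ω | Conn ends ω a₂ b} := rfl
  rw [e, eb] at key
  linarith

/-- **`M ≥ 0`** (Harris): `P(a₂ ↔ o) · P(a₂ ↔ b) ≤ P(a₂ ↔ o, a₂ ↔ b)`. -/
theorem M_nonneg : 0 ≤ (prob p {ω | Conn ends ω a₂ o ∧ Conn ends ω a₂ b} - prob p {ω | Conn ends ω a₂ o} * prob p {ω | Conn ends ω a₂ b}) := by
  have key := prob_mul_prob_le_prob_inter hp (isUpperSet_connEvent ends a₂ o) (isUpperSet_connEvent ends a₂ b)
  have e : connEvent ends a₂ o ∩ connEvent ends a₂ b = {ω | Conn ends ω a₂ o ∧ Conn ends ω a₂ b} := rfl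
  have eo : connEvent ends a₂ o = {ω | Conn ends ω a₂ o} := rfl
  have eb : connEvent ends a₂ b = {ω | Conn ends ω a₂ b} := rfl
  rw [e, eo, eb] at key
  linarith

/-- **`Mbx ≥ 0`** (Harris): `P(a₂ ↔ v) · P(a₂ ↔ b) ≤ P(a₂ ↔ v, a₂ ↔ b)`. -/
theorem Mbx_nonneg : 0 ≤ (prob p {ω | Conn ends ω a₂ v ∧ Conn ends ω a₂ b} - prob p {ω | Conn ends ω a₂ v} * prob p {ω | Conn ends ω a₂ b}) := by
  have key := prob_mul_prob_le_prob_inter hp (isUpperSet_connEvent ends a₂ v) (isUpperSet_connEvent ends a₂ b)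
  have e : connEvent ends a₂ v ∩ connEvent ends a₂ b = {ω | Conn ends ω a₂ v ∧ Conn ends ω a₂ b} := rfl
  have ex : connEvent ends a₂ v = {ω | Conn ends ω a₂ v} := rfl
  have eb : connEvent ends a₂ b = {ω | Conn ends ω a₂ b} := rfl
  rw [e, ex, eb] at key
  linarith

omit [Fintype E] [DecidableEq E] hp in
/-- The up-set `{W | x ∈ W}`. -/
lemma isUpperSet_mem (x : V) : IsUpperSet {W : Set V | x ∈ W} := fun _ _ hST hW => hST hW

omit [Fintype E] [DecidableEq E] hp in
/-- `{C(s) ∋ x} = {s ↔ x}`. -/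
lemma clusterInEvent_mem_eq (s x : V) : clusterInEvent ends s {W : Set V | x ∈ W} = connEvent ends s x := by
  ext ω
  simp [clusterInEvent]

omit [Fintype E] [DecidableEq E] hp in
/-- `{a₂ ↮ {v}} = {a₂ ↮ v}`. -/
lemma avoidAll_singleton_eq [DecidableEq V] : avoidAll ends a₂ {v} = {ω | ¬ Conn ends ω a₂ v} := by
  ext ω
  simp [avoidAll]

/-- **`XLH ≥ 0`** (BHK06 Thm 1.3, cross clusters, `v` avoided):
`P(a₂ ↮ v, v ↔ b, a₂ ↔ o) · P(a₂ ↮ v) ≤ P(a₂ ↮ v, v ↔ b) · P(a₂ ↮ v, a₂ ↔ o)`. -/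
theorem XLH_nonneg [Fintype V] [DecidableEq V] : 0 ≤ (prob p {ω | ¬ Conn ends ω a₂ v ∧ Conn ends ω v b} * prob p {ω | ¬ Conn ends ω a₂ v ∧ Conn ends ω a₂ o} - prob p {ω | ¬ Conn ends ω a₂ v} * prob p {ω | ¬ Conn ends ω a₂ v ∧ Conn ends ω v b ∧ Conn ends ω a₂ o}) := by
  have key := bhk_cross_cluster_avoid p hp ends a₂ v (X := {v}) (Finset.mem_singleton_self v)
    (isUpperSet_mem o) (isUpperSet_mem b)
  rw [clusterInEvent_mem_eq, clusterInEvent_mem_eq, avoidAll_singleton_eq] at key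
  have e1 : connEvent ends a₂ o ∩ connEvent ends v b ∩ {ω | ¬ Conn ends ω a₂ v} = {ω | ¬ Conn ends ω a₂ v ∧ Conn ends ω v b ∧ Conn ends ω a₂ o} := by
    ext ω; simp only [Set.mem_inter_iff, mem_connEvent, Set.mem_setOf_eq]; tauto
  have e2 : connEvent ends a₂ o ∩ {ω | ¬ Conn ends ω a₂ v} = {ω | ¬ Conn ends ω a₂ v ∧ Conn ends ω a₂ o} := by
    ext ω; simp only [Set.mem_inter_iff, mem_connEvent, Set.mem_setOf_eq]; tauto
  have e3 : connEvent ends v b ∩ {ω | ¬ Conn ends ω a₂ v} = {ω | ¬ Conn ends ω a₂ v ∧ Conn ends ω v b} := by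
    ext ω; simp only [Set.mem_inter_iff, mem_connEvent, Set.mem_setOf_eq]; tauto
  rw [e1, e2, e3] at key
  linarith

/-- **`XHL ≥ 0`** (BHK06 Thm 1.3, cross clusters, `v` avoided):
`P(a₂ ↮ v, a₂ ↔ b, v ↔ o) · P(a₂ ↮ v) ≤ P(a₂ ↮ v, a₂ ↔ b) · P(a₂ ↮ v, v ↔ o)`. -/
theorem XHL_nonneg [Fintype V] [DecidableEq V] : 0 ≤ (prob p {ω | ¬ Conn ends ω a₂ v ∧ Conn ends ω a₂ b} * prob p {ω | ¬ Conn ends ω a₂ v ∧ Conn ends ω v o} - prob p {ω | ¬ Conn ends ω a₂ v} * prob p {ω | ¬ Conn ends ω a₂ v ∧ Conn ends ω a₂ b ∧ Conn ends ω v o}) := by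
  have key := bhk_cross_cluster_avoid p hp ends a₂ v (X := {v}) (Finset.mem_singleton_self v)
    (isUpperSet_mem b) (isUpperSet_mem o)
  rw [clusterInEvent_mem_eq, clusterInEvent_mem_eq, avoidAll_singleton_eq] at key
  have e1 : connEvent ends a₂ b ∩ connEvent ends v o ∩ {ω | ¬ Conn ends ω a₂ v} = {ω | ¬ Conn ends ω a₂ v ∧ Conn ends ω a₂ b ∧ Conn ends ω v o} := by
    ext ω; simp only [Set.mem_inter_iff, mem_connEvent, Set.mem_setOf_eq]; tauto
  have e2 : connEvent ends a₂ b ∩ {ω | ¬ Conn ends ω a₂ v} = {ω | ¬ Conn ends ω a₂ v ∧ Conn ends ω a₂ b} := by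
    ext ω; simp only [Set.mem_inter_iff, mem_connEvent, Set.mem_setOf_eq]; tauto
  have e3 : connEvent ends v o ∩ {ω | ¬ Conn ends ω a₂ v} = {ω | ¬ Conn ends ω a₂ v ∧ Conn ends ω v o} := by
    ext ω; simp only [Set.mem_inter_iff, mem_connEvent, Set.mem_setOf_eq]; tauto
  rw [e1, e2, e3] at key
  linarith

/-- **`SHH ≥ 0`** (BHK06 Thm 1.3, same cluster, given `a₂ ↮ v`):
`P(a₂ ↮ v, a₂ ↔ b) · P(a₂ ↮ v, a₂ ↔ o) ≤ P(a₂ ↮ v, a₂ ↔ b, a₂ ↔ o) · P(a₂ ↮ v)`. -/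
theorem SHH_nonneg [Fintype V] [DecidableEq V] : 0 ≤ (prob p {ω | ¬ Conn ends ω a₂ v} * prob p {ω | ¬ Conn ends ω a₂ v ∧ Conn ends ω a₂ b ∧ Conn ends ω a₂ o} - prob p {ω | ¬ Conn ends ω a₂ v ∧ Conn ends ω a₂ b} * prob p {ω | ¬ Conn ends ω a₂ v ∧ Conn ends ω a₂ o}) := by
  have key := bhk_same_cluster_events p hp ends a₂ v
    (isUpperSet_mem b) (isUpperSet_mem o)
  rw [clusterInEvent_mem_eq, clusterInEvent_mem_eq, ← notConn_eq_compl (ends := ends) (v := v) (a₂ := a₂)] at key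
  have e1 : connEvent ends a₂ b ∩ connEvent ends a₂ o ∩ {ω | ¬ Conn ends ω a₂ v} = {ω | ¬ Conn ends ω a₂ v ∧ Conn ends ω a₂ b ∧ Conn ends ω a₂ o} := by
    ext ω; simp only [Set.mem_inter_iff, mem_connEvent, Set.mem_setOf_eq]; tauto
  have e2 : connEvent ends a₂ b ∩ {ω | ¬ Conn ends ω a₂ v} = {ω | ¬ Conn ends ω a₂ v ∧ Conn ends ω a₂ b} := by
    ext ω; simp only [Set.mem_inter_iff, mem_connEvent, Set.mem_setOf_eq]; tauto
  have e3 : connEvent ends a₂ o ∩ {ω | ¬ Conn ends ω a₂ v} = {ω | ¬ Conn ends ω a₂ v ∧ Conn ends ω a₂ o} := by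
    ext ω; simp only [Set.mem_inter_iff, mem_connEvent, Set.mem_setOf_eq]; tauto
  rw [e1, e2, e3] at key
  linarith

/-- When `Q = P(a₂ ↮ v) = 0`, every `Q′`-probability vanishes: the five used below. -/
theorem Qp_atoms_eq_zero (hQ : prob p {ω | ¬ Conn ends ω a₂ v} = 0) :
    prob p {ω | ¬ Conn ends ω a₂ v ∧ Conn ends ω a₂ o} = 0 ∧ prob p {ω | ¬ Conn ends ω a₂ v ∧ Conn ends ω v o} = 0 ∧ prob p {ω | ¬ Conn ends ω a₂ v ∧ Conn ends ω a₂ b} = 0 ∧ prob p {ω | ¬ Conn ends ω a₂ v ∧ Conn ends ω v b} = 0 ∧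
      prob p {ω | ¬ Conn ends ω a₂ v ∧ Conn ends ω v b ∧ Conn ends ω a₂ o} = 0 ∧ prob p {ω | ¬ Conn ends ω a₂ v ∧ Conn ends ω a₂ b ∧ Conn ends ω v o} = 0 ∧ prob p {ω | ¬ Conn ends ω a₂ v ∧ Conn ends ω a₂ b ∧ Conn ends ω a₂ o} = 0 := by
  refine ⟨?_, ?_, ?_, ?_, ?_, ?_, ?_⟩ <;>
    exact le_antisymm (hQ ▸ prob_mono hp fun ω hω => hω.1) (prob_nonneg hp _)

/-- **`L1 ≥ 0`**: `Q · L1 = pbL · HAo + XLH` and the case `Q = 0`. -/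
theorem L1_nonneg [Fintype V] [DecidableEq V] : 0 ≤ (prob p {ω | Conn ends ω a₂ o} * prob p {ω | ¬ Conn ends ω a₂ v ∧ Conn ends ω v b} - prob p {ω | ¬ Conn ends ω a₂ v ∧ Conn ends ω v b ∧ Conn ends ω a₂ o}) := by
  have hHAo := HAo_nonneg (ends := ends) (v := v) (o := o) (a₂ := a₂) p hp
  have hXLH := XLH_nonneg (ends := ends) (v := v) (o := o) (b := b) (a₂ := a₂) p hp
  have hpbL := prob_nonneg hp {ω | ¬ Conn ends ω a₂ v ∧ Conn ends ω v b}
  have hid : prob p {ω | ¬ Conn ends ω a₂ v} * ((prob p {ω | Conn ends ω a₂ o} * prob p {ω | ¬ Conn ends ω a₂ v ∧ Conn ends ω v b} - prob p {ω | ¬ Conn ends ω a₂ v ∧ Conn ends ω v b ∧ Conn ends ω a₂ o})) = prob p {ω | ¬ Conn ends ω a₂ v ∧ Conn ends ω v b} * ((prob p {ω | ¬ Conn ends ω a₂ v} * prob p {ω | Conn ends ω a₂ o} - prob p {ω | ¬ Conn ends ω a₂ v ∧ Conn ends ω a₂ o})) + ((prob p {ω | ¬ Conn ends ω a₂ v ∧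 Conn ends ω v b} * prob p {ω | ¬ Conn ends ω a₂ v ∧ Conn ends ω a₂ o} - prob p {ω | ¬ Conn ends ω a₂ v} * prob p {ω | ¬ Conn ends ω a₂ v ∧ Conn ends ω v b ∧ Conn ends ω a₂ o})) := by ring
  have hprod : 0 ≤ prob p {ω | ¬ Conn ends ω a₂ v} * ((prob p {ω | Conn ends ω a₂ o} * prob p {ω | ¬ Conn ends ω a₂ v ∧ Conn ends ω v b} - prob p {ω | ¬ Conn ends ω a₂ v ∧ Conn ends ω v b ∧ Conn ends ω a₂ o})) := by
    rw [hid]; exact add_nonneg (mul_nonneg hpbL hHAo) hXLH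
  rcases (prob_nonneg hp {ω | ¬ Conn ends ω a₂ v}).lt_or_eq with hQ | hQ
  · exact nonneg_of_mul_nonneg_right hprod hQ
  · obtain ⟨-, -, -, h4, h5, -, -⟩ := Qp_atoms_eq_zero (ends := ends) (v := v) (o := o) (b := b) (a₂ := a₂) p hp hQ.symm
    rw [h4, h5]; simp

/-- **`L2 ≥ 0`**: `Q · L2 = poL · HAb + XHL` and the case `Q = 0`. -/
theorem L2_nonneg [Fintype V] [DecidableEq V] : 0 ≤ (prob p {ω | Conn ends ω a₂ b} * prob p {ω | ¬ Conn ends ω a₂ v ∧ Conn ends ω v o} - prob p {ω | ¬ Conn ends ω a₂ v ∧ Conn ends ω a₂ b ∧ Conn ends ω v o}) := by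
  have hHAb := HAb_nonneg (ends := ends) (v := v) (b := b) (a₂ := a₂) p hp
  have hXHL := XHL_nonneg (ends := ends) (v := v) (o := o) (b := b) (a₂ := a₂) p hp
  have hpoL := prob_nonneg hp {ω | ¬ Conn ends ω a₂ v ∧ Conn ends ω v o}
  have hid : prob p {ω | ¬ Conn ends ω a₂ v} * ((prob p {ω | Conn ends ω a₂ b} * prob p {ω | ¬ Conn ends ω a₂ v ∧ Conn ends ω v o} - prob p {ω | ¬ Conn ends ω a₂ v ∧ Conn ends ω a₂ b ∧ Conn ends ω v o})) = prob p {ω | ¬ Conn ends ω a₂ v ∧ Conn ends ω v o} * ((prob p {ω | ¬ Conn ends ω a₂ v} * prob p {ω | Conn ends ω a₂ b} - prob p {ω | ¬ Conn ends ω a₂ v ∧ Conn ends ω a₂ b})) + ((prob p {ω | ¬ Conn ends ω a₂ v ∧ Conn ends ω a₂ b} * prob p {ω | ¬ Conn ends ω a₂ v ∧ Conn ends ω v o} - prob p {ω | ¬ Conn ends ω a₂ v} * prob p {ω | ¬ Conn ends ω a₂ v ∧ Conn ends ω a₂ b ∧ Conn ends ω v o})) := by ring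
  have hprod : 0 ≤ prob p {ω | ¬ Conn ends ω a₂ v} * ((prob p {ω | Conn ends ω a₂ b} * prob p {ω | ¬ Conn ends ω a₂ v ∧ Conn ends ω v o} - prob p {ω | ¬ Conn ends ω a₂ v ∧ Conn ends ω a₂ b ∧ Conn ends ω v o})) := by
    rw [hid]; exact add_nonneg (mul_nonneg hpoL hHAb) hXHL
  rcases (prob_nonneg hp {ω | ¬ Conn ends ω a₂ v}).lt_or_eq with hQ | hQ
  · exact nonneg_of_mul_nonneg_right hprod hQ
  · obtain ⟨-, h2, -, -, -, h6, -⟩ := Qp_atoms_eq_zero (ends := ends) (v := v) (o := o) (b := b) (a₂ := a₂) p hp hQ.symm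
    rw [h2, h6]; simp

/-- **`Kh ≥ 0`** (mine-2's (K), halved): `Q · Kh = SHH + XLH + HAo · (HAb + pbL)` and the case
`Q = 0`. -/
theorem Kh_nonneg [Fintype V] [DecidableEq V] : 0 ≤ ((((prob p {ω | Conn ends ω a₂ o} * prob p {ω | ¬ Conn ends ω a₂ v ∧ Conn ends ω v b} - prob p {ω | ¬ Conn ends ω a₂ v ∧ Conn ends ω v b ∧ Conn ends ω a₂ o}) + prob p {ω | ¬ Conn ends ω a₂ v ∧ Conn ends ω a₂ b ∧ Conn ends ω a₂ o}) + prob p {ω | Conn ends ω a₂ b} * (prob p {ω | ¬ Conn ends ω a₂ v} * prob p {ω | Conn ends ω a₂ o} - prob p {ω | ¬ Conn ends ω a₂ v ∧ Conn ends ω a₂ o})) - prob p {ω | Conn ends ω a₂ o} * prob p {ω | ¬ Conn ends ω a₂ v ∧ Conn ends ω a₂ b}) := by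
  have hHAo := HAo_nonneg (ends := ends) (v := v) (o := o) (a₂ := a₂) p hp
  have hHAb := HAb_nonneg (ends := ends) (v := v) (b := b) (a₂ := a₂) p hp
  have hXLH := XLH_nonneg (ends := ends) (v := v) (o := o) (b := b) (a₂ := a₂) p hp
  have hSHH := SHH_nonneg (ends := ends) (v := v) (o := o) (b := b) (a₂ := a₂) p hp
  have hpbL := prob_nonneg hp {ω | ¬ Conn ends ω a₂ v ∧ Conn ends ω v b}
  have hid : prob p {ω | ¬ Conn ends ω a₂ v} * (((((prob p {ω | Conn ends ω a₂ o} * prob p {ω | ¬ Conn ends ω a₂ v ∧ Conn ends ω v b} - prob p {ω | ¬ Conn ends ω a₂ v ∧ Conn ends ω v b ∧ Conn ends ω a₂ o}) + prob p {ω | ¬ Conn ends ω a₂ v ∧ Conn ends ω a₂ b ∧ Conn ends ω a₂ o}) + prob p {ω | Conn ends ω a₂ b} * (prob p {ω | ¬ Conn ends ω a₂ v} * prob p {ω | Conn ends ω a₂ o} - prob p {ω | ¬ Conn ends ω a₂ v ∧ Conn ends ω a₂ o})) - prob p {ω | Conn ends ω a₂ o} * prob p {ω | ¬ Conn ends ω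 a₂ v ∧ Conn ends ω a₂ b})) = ((prob p {ω | ¬ Conn ends ω a₂ v} * prob p {ω | ¬ Conn ends ω a₂ v ∧ Conn ends ω a₂ b ∧ Conn ends ω a₂ o} - prob p {ω | ¬ Conn ends ω a₂ v ∧ Conn ends ω a₂ b} * prob p {ω | ¬ Conn ends ω a₂ v ∧ Conn ends ω a₂ o})) + ((prob p {ω | ¬ Conn ends ω a₂ v ∧ Conn ends ω v b} * prob p {ω | ¬ Conn ends ω a₂ v ∧ Conn ends ω a₂ o} - prob p {ω | ¬ Conn ends ω a₂ v} * prob p {ω | ¬ Conn ends ω a₂ v ∧ Conn ends ω v b ∧ Conn ends ω a₂ o})) + ((prob p {ω | ¬ Conn ends ω a₂ v} * prob p {ω | Conn ends ω a₂ o} - prob p {ω | ¬ Conn ends ω a₂ v ∧ Conn ends ω a₂ o})) * (((prob p {ω | ¬ Conn ends ω a₂ v} * prob p {ω | Conn ends ω a₂ b} - prob p {ω | ¬ Conn ends ω a₂ v ∧ Conn ends ω a₂ b})) + prob p {ω | ¬ Conn ends ω a₂ v ∧ Conn ends ω v b}) := by ring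
  have hprod : 0 ≤ prob p {ω | ¬ Conn ends ω a₂ v} * (((((prob p {ω | Conn ends ω a₂ o} * prob p {ω | ¬ Conn ends ω a₂ v ∧ Conn ends ω v b} - prob p {ω | ¬ Conn ends ω a₂ v ∧ Conn ends ω v b ∧ Conn ends ω a₂ o}) + prob p {ω | ¬ Conn ends ω a₂ v ∧ Conn ends ω a₂ b ∧ Conn ends ω a₂ o}) + prob p {ω | Conn ends ω a₂ b} * (prob p {ω | ¬ Conn ends ω a₂ v} * prob p {ω | Conn ends ω a₂ o} - prob p {ω | ¬ Conn ends ω a₂ v ∧ Conn ends ω a₂ o})) - prob p {ω | Conn ends ω a₂ o} * prob p {ω | ¬ Conn ends ω a₂ v ∧ Conn ends ω a₂ b})) := by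
    rw [hid]; exact add_nonneg (add_nonneg hSHH hXLH) (mul_nonneg hHAo (add_nonneg hHAb hpbL))
  rcases (prob_nonneg hp {ω | ¬ Conn ends ω a₂ v}).lt_or_eq with hQ | hQ
  · exact nonneg_of_mul_nonneg_right hprod hQ
  · obtain ⟨h1, -, h3, h4, h5, -, h7⟩ := Qp_atoms_eq_zero (ends := ends) (v := v) (o := o) (b := b) (a₂ := a₂) p hp hQ.symm
    rw [h1, h3, h4, h5, h7, ← hQ]; simp

end A13Blocks

section A13Class

variable {V : Type*} {E : Type*} [Fintype E] [DecidableEq E] {R : Type*} [Field R]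
variable {ends : E → Sym2 V} {side : E → Bool} {L : Set V} {v : V} {Rt : Set V}

variable (h : CutVertex ends side L v Rt) {o b a₁ a₂ a₃ : V} (p : E → R)
include h

/-- **(HCOV) with a root and `a₃` behind a cut vertex** — the seventh two-far-mark class of S3.5 in
the kernel (MINE2-CUTVERTEX §13.12), unconditionally, every admissible weight vector. -/
theorem HCov_a13Far [Fintype V] [DecidableEq V] [LinearOrder R] [IsStrictOrderedRing R]
    (h1 : a₁ ∈ L ∨ a₁ = v) (h3 : a₃ ∈ L ∨ a₃ = v) (h2 : a₂ ∈ Rt ∨ a₂ = v) (ho : o ∈ Rt ∨ o = v)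
    (hb : b ∈ Rt ∨ b = v) (hp : IsProbVec p) : HCov p ends o a₁ a₂ a₃ b :=
  HCov_a13Far_of_gens h p h1 h3 h2 ho hb hp
    (HAo_nonneg p hp)
    (HAb_nonneg p hp)
    (M_nonneg p hp)
    (Mbx_nonneg p hp)
    (XLH_nonneg p hp)
    (XHL_nonneg p hp)
    (SHH_nonneg p hp)
    (L1_nonneg p hp)
    (L2_nonneg p hp)
    (Kh_nonneg p hp)

end A13Class

end CutTwoFar

end Summit.Ventures.PercRepro2
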